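import Summits.HubbardSuperconductivity.HubbardSuperconductivity.Theorems.KLProgrammeKLRegimeScaleZeroCovarianceOffSiteExplicit

/-!
# Route `KLProgramme`, crux K3 — engine-flow child (stmt-HubbardSuperconductivity-20437), stub (C) at `n = 0`, located item #22a «(C)-SCALE0-PT2»,
# §2a (L) SUMMED OVER ALL FREQUENCIES: off site, the full Matsubara series of the scale-`0` covariance entry on the torus `L` equals the series of the
# INFINITE-LATTICE kernel `(1/β)Σ_n e^{iω_nΔτ} a_{ω_n}(−z)` up to an `L`-tail that is uniform in `β` and in the times

Cell gate-hubbard-kl, seat p1 g20.  With `…OffSiteWindow` ((M): window → full series, `O(β/M)`), `…TorusPeriodisation` (per-frequency torus comparison,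
D7) and `…MomentumJets` §6 (the frequency-summable jet constant `O(1/m(ω)²)`), this file sums the torus comparison over ALL Matsubara frequencies:

* §1 `uvSymbolFn_eq_mul_one` — homogeneity `Ψ_c = c·Ψ_1` (the engine's `c = βL²` against the kernel's `c = 1`);
  `freqTerm_eq_torusFourierInv_one` — `(βL²)⁻²e^{iωΔτ}Σ_kχ_k(z̄)Ψ_{βL²}(ω,e_K(k)) = (1/β)e^{iωΔτ}·torusFourierInv(sample of g¹_ω)(z̄)`;
* §2 **`norm_freqTerm_sub_kernelTerm_le`** — per frequency `ω ≠ 0`: `‖F_L(ω) − (1/β)e^{iωΔτ}a¹_ω(−z)‖ ≤ (1/β)·D/(2π)^N·(2/(2R+2))^{N−4}·4C₂` for every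
  `L ≥ R + 1 + Σ|z_j|`, from the momentum-jet bound `‖D^N g¹_ω‖ ≤ D`;
* §3 **`norm_tsum_freqTerm_sub_tsum_kernelTerm_le`** — if `‖D^N g¹_ω‖ ≤ D₀/m(ω)²` for all `ω ≠ 0` (the shape of `…MomentumJets` §6), and the
  torus series is summable (off site: `…OffSiteWindow`), then the kernel series is summable and
  `‖Σ'_n F_L(ω_n) − Σ'_n (1/β)e^{iω_nΔτ}a¹_{ω_n}(−z)‖ ≤ D₀·(2/Λ)·(2/(2R+2))^{N−4}·4C₂/(2π)^N` — uniformly in `β` (`Σ_n 1/(βm(ω_n)²) ≤ 2/Λ`) and in `Δτ`;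
* §4 the BARE FRAME with the proved cutoff table: `norm_iteratedFDeriv_uvSpatialSymbol_one_bare_le_envSq` (`D₀ = N!·klChi2CauchyTab N·(N+1)!·4·max(1,4/Λ)^{N−1}·(8π)^N`),
  **`norm_tsum_freqTerm_sub_tsum_kernelTerm_le_bare`**, and with (M) **`norm_sum_freqTerm_sub_tsum_kernelTerm_le_bare`**:
  `‖Σ_{i∈MatsubaraIdx M} F_L(ω_i) − Σ'_n (1/β)e^{iω_nΔτ}a¹_{ω_n}(−z)‖ ≤ (19/3)(4+|μ|)·β/(2π²M) + D₀·(2/Λ)·(2/(2R+2))^{N−4}·4C₂/(2π)^N`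
  for `z̄ ≠ 0`, every `L ≥ R+1+Σ|z_j|`, every real `Δτ` — the off-site scale-`0` entry IS the infinite-lattice frequency series up to two explicit tails
  (the certified object of SPEC v2 §2a, before the Poisson step of §2c).

Proofs only; no definitions; nothing here asserts (C), any stub of 20437, K3 or superconductivity.  References: BGM 2006 §2.1 (2.3)–(2.6a), §2.2 fn. 1
[cite: BenfattoGiulianiMastropietro2006]; Glimm–Jaffe 1987 Prop. 7.3.1 [cite: GlimmJaffeQP1987].
-/

noncomputable section

namespace Summit.HubbardSuperconductivity.HubbardSuperconductivity.Theorems.KLRegimeSplit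

set_option linter.dupNamespace false -- summit = problem name (single-conjunct summit), D-0017

open Literature.MathematicalPhysics.QuantumLattice Literature.Probability.LatticeModels Literature.Analysis.FunctionSpaces
open Summit.HubbardSuperconductivity.HubbardSuperconductivity.Theorems.DispersionFlow
open Finset Complex UnitAddTorus Real
open scoped Nat

variable {L : ℕ} [NeZero L]

/-! ## §1 Homogeneity in `c` and the frequency term as `(1/β)e^{iωΔτ}·torusFourierInv` of the `c = 1` symbol -/

/-- `Ψ_c(ω,e) = c·Ψ_1(ω,e)`. -/
theorem uvSymbolFn_eq_mul_one (c Λ e om : ℝ) : uvSymbolFn c Λ e om = (c : ℂ) * uvSymbolFn 1 Λ e om := by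
  simp only [uvSymbolFn, resolventFn, Complex.ofReal_one]
  ring

/-- **The frequency term in the `c = 1` currency**: for `0 < β`,
`(βL²)⁻²·e^{iωΔτ}·Σ_kχ_k(z̄)Ψ_{βL²}(ω, e_K(k)) = (1/β)·e^{iωΔτ}·torusFourierInv (k ↦ g¹_ω(k/L)) (z̄)`. -/
theorem freqTerm_eq_torusFourierInv_one {β : ℝ} (hβ : 0 < β) (Λ μ : ℝ) (K : TrigPolyC4v) (om Δτ : ℝ) (z : Site 2) :
    ((1 / (β * (L : ℝ) ^ 2) : ℝ) : ℂ) ^ 2 * cexp (I * ((om * Δτ : ℝ) : ℂ)) *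
        ∑ k, torusChar k (Torus.proj L z) * uvSymbolFn (β * (L : ℝ) ^ 2) Λ (nambuXiCT L μ K k) om =
      ((1 / β : ℝ) : ℂ) * cexp (I * ((om * Δτ : ℝ) : ℂ)) * torusFourierInv (fun kv : TorusSite 2 L =>
        (fun y : Momentum => uvSymbolFn 1 Λ (frameLevel μ K ((2 * π) • y)) om) (WithLp.toLp 2 fun i => ((kv i).val : ℝ) / L)) (Torus.proj L z) := by
  have hL : (L : ℂ) ≠ 0 := Nat.cast_ne_zero.2 (NeZero.ne L)
  have hβ' : (β : ℂ) ≠ 0 := by exact_mod_cast hβ.ne'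
  have hsum : ∑ k, torusChar k (Torus.proj L z) * uvSymbolFn (β * (L : ℝ) ^ 2) Λ (nambuXiCT L μ K k) om =
      ((β * (L : ℝ) ^ 2 : ℝ) : ℂ) * ∑ k, torusChar k (Torus.proj L z) * uvSymbolFn 1 Λ (nambuXiCT L μ K k) om := by
    rw [Finset.mul_sum]
    refine Finset.sum_congr rfl fun k _ => ?_
    rw [uvSymbolFn_eq_mul_one (β * (L : ℝ) ^ 2)]
    ring
  rw [hsum, sum_torusChar_mul_uvSymbol_eq_torusFourierInv]
  push_cast
  field_simp

/-! ## §2 Per frequency: the torus term versus the infinite-lattice kernel term -/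

/-- **Per-frequency torus comparison in the entry's normalisation**: for `0 < β`, `ω ≠ 0`, `N ≥ 4`, a momentum-jet bound `‖D^N g¹_ω‖ ≤ D`, every box
radius `R` and every `L ≥ R + 1 + Σ_j|z_j|`:
`‖F_L(ω) − (1/β)e^{iωΔτ}a¹_ω(−z)‖ ≤ (1/β)·D/(2π)^N·(2/(2R+2))^{N−4}·4C₂` (`…TorusPeriodisation.norm_torusFourierInv_uvSpatialSample_sub_kernel_le`). -/
theorem norm_freqTerm_sub_kernelTerm_le {β : ℝ} (hβ : 0 < β) (Λ μ : ℝ) (K : TrigPolyC4v) {om : ℝ} (hom : om ≠ 0) (Δτ : ℝ) {N : ℕ}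
    (hN : 2 * 2 ≤ N) {D : ℝ} (hD : ∀ y : Momentum, ‖iteratedFDeriv ℝ N (fun y : Momentum => uvSymbolFn 1 Λ (frameLevel μ K ((2 * π) • y)) om) y‖ ≤ D)
    {R : ℕ} (z : Site 2) (hR : (R : ℤ) + 1 + ∑ i, |z i| ≤ L) :
    ‖((1 / (β * (L : ℝ) ^ 2) : ℝ) : ℂ) ^ 2 * cexp (I * ((om * Δτ : ℝ) : ℂ)) *
          ∑ k, torusChar k (Torus.proj L z) * uvSymbolFn (β * (L : ℝ) ^ 2) Λ (nambuXiCT L μ K k) om -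
        ((1 / β : ℝ) : ℂ) * cexp (I * ((om * Δτ : ℝ) : ℂ)) * mFourierCoeff (Torus.descend
          (fun y : Momentum => uvSymbolFn 1 Λ (frameLevel μ K ((2 * π) • y)) om) (uvSpatialSymbol_isLatticePeriodic 1 Λ μ K om)) (-z)‖ ≤
      (1 / β) * (D / (2 * Real.pi) ^ N * (2 / ((2 * R + 2 : ℕ) : ℝ)) ^ (N - 2 * 2) * (2 ^ 2 * ∑' k : Site 2, ∏ j, (1 + (k j : ℝ) ^ 2)⁻¹)) := by
  rw [freqTerm_eq_torusFourierInv_one hβ, ← mul_sub, norm_mul, norm_mul, Complex.norm_real, Real.norm_of_nonneg (by positivity)]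
  have hexp : ‖cexp (I * ((om * Δτ : ℝ) : ℂ))‖ = 1 := by rw [mul_comm, Complex.norm_exp_ofReal_mul_I]
  rw [hexp, mul_one]
  exact mul_le_mul_of_nonneg_left (norm_torusFourierInv_uvSpatialSample_sub_kernel_le 1 μ K hom hN hD z hR) (by positivity)

/-! ## §3 Summed over all Matsubara frequencies, uniformly in `β` -/

/-- **(L) summed over ALL frequencies**: for `0 < β`, `0 < Λ`, `N ≥ 4`, a FREQUENCY-SUMMABLE jet bound `‖D^N g¹_ω(y)‖ ≤ D₀/m(ω)²` for all `ω ≠ 0`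
(`m(ω) = max(|ω|, Λ/2)`; the shape of `…MomentumJets` §6), every box radius `R`, every `L ≥ R + 1 + Σ_j|z_j|`, every real `Δτ`, and a summable
torus series (`…OffSiteWindow` off site): the kernel series is summable and
`‖Σ'_n F_L(ω_n) − Σ'_n (1/β)e^{iω_nΔτ}a¹_{ω_n}(−z)‖ ≤ D₀·(2/Λ)·(1/(2π)^N·(2/(2R+2))^{N−4}·4C₂)` (`Σ_n 1/(β·m(ω_n)²) ≤ 2/Λ`). -/
theorem norm_tsum_freqTerm_sub_tsum_kernelTerm_le {β : ℝ} (hβ : 0 < β) {Λ : ℝ} (hΛ : 0 < Λ) (μ : ℝ) (K : TrigPolyC4v) (Δτ : ℝ) {N : ℕ}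
    (hN : 2 * 2 ≤ N) {D₀ : ℝ} (hD₀ : 0 ≤ D₀)
    (hD : ∀ om : ℝ, om ≠ 0 → ∀ y : Momentum,
      ‖iteratedFDeriv ℝ N (fun y : Momentum => uvSymbolFn 1 Λ (frameLevel μ K ((2 * π) • y)) om) y‖ ≤ D₀ / max |om| (Λ / 2) ^ 2)
    {R : ℕ} (z : Site 2) (hR : (R : ℤ) + 1 + ∑ i, |z i| ≤ L)
    (hFs : Summable (fun n : ℤ => ((1 / (β * (L : ℝ) ^ 2) : ℝ) : ℂ) ^ 2 * cexp (I * (((2 * n + 1) * π / β * Δτ : ℝ) : ℂ)) *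
        ∑ k, torusChar k (Torus.proj L z) * uvSymbolFn (β * (L : ℝ) ^ 2) Λ (nambuXiCT L μ K k) ((2 * n + 1) * π / β))) :
    Summable (fun n : ℤ => ((1 / β : ℝ) : ℂ) * cexp (I * (((2 * n + 1) * π / β * Δτ : ℝ) : ℂ)) * mFourierCoeff (Torus.descend
        (fun y : Momentum => uvSymbolFn 1 Λ (frameLevel μ K ((2 * π) • y)) ((2 * n + 1) * π / β))
        (uvSpatialSymbol_isLatticePeriodic 1 Λ μ K ((2 * n + 1) * π / β))) (-z)) ∧
    ‖∑' n : ℤ, ((1 / (β * (L : ℝ) ^ 2) : ℝ) : ℂ) ^ 2 * cexp (I * (((2 * n + 1) * π / β * Δτ : ℝ) : ℂ)) *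
          ∑ k, torusChar k (Torus.proj L z) * uvSymbolFn (β * (L : ℝ) ^ 2) Λ (nambuXiCT L μ K k) ((2 * n + 1) * π / β) -
        ∑' n : ℤ, ((1 / β : ℝ) : ℂ) * cexp (I * (((2 * n + 1) * π / β * Δτ : ℝ) : ℂ)) * mFourierCoeff (Torus.descend
          (fun y : Momentum => uvSymbolFn 1 Λ (frameLevel μ K ((2 * π) • y)) ((2 * n + 1) * π / β))
          (uvSpatialSymbol_isLatticePeriodic 1 Λ μ K ((2 * n + 1) * π / β))) (-z)‖ ≤
      D₀ * (2 / Λ) * (1 / (2 * Real.pi) ^ N * (2 / ((2 * R + 2 : ℕ) : ℝ)) ^ (N - 2 * 2) * (2 ^ 2 * ∑' k : Site 2, ∏ j, (1 + (k j : ℝ) ^ 2)⁻¹)) := by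
  set F : ℤ → ℂ := fun n => ((1 / (β * (L : ℝ) ^ 2) : ℝ) : ℂ) ^ 2 * cexp (I * (((2 * n + 1) * π / β * Δτ : ℝ) : ℂ)) *
    ∑ k, torusChar k (Torus.proj L z) * uvSymbolFn (β * (L : ℝ) ^ 2) Λ (nambuXiCT L μ K k) ((2 * n + 1) * π / β) with hF
  set A : ℤ → ℂ := fun n => ((1 / β : ℝ) : ℂ) * cexp (I * (((2 * n + 1) * π / β * Δτ : ℝ) : ℂ)) * mFourierCoeff (Torus.descend
    (fun y : Momentum => uvSymbolFn 1 Λ (frameLevel μ K ((2 * π) • y)) ((2 * n + 1) * π / β))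
    (uvSpatialSymbol_isLatticePeriodic 1 Λ μ K ((2 * n + 1) * π / β))) (-z) with hA
  set cNR : ℝ := 1 / (2 * Real.pi) ^ N * (2 / ((2 * R + 2 : ℕ) : ℝ)) ^ (N - 2 * 2) * (2 ^ 2 * ∑' k : Site 2, ∏ j, (1 + (k j : ℝ) ^ 2)⁻¹) with hcNR
  have hC₂ : 0 ≤ ∑' k : Site 2, ∏ j, (1 + (k j : ℝ) ^ 2)⁻¹ := tsum_nonneg fun k => Finset.prod_nonneg fun j _ => by positivity
  have hcNR0 : 0 ≤ cNR := by positivity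
  -- per-frequency differences are dominated by `(D₀·cNR)·1/(β m(ω_n)²)`
  have hω : ∀ n : ℤ, ((2 * n + 1) * π / β : ℝ) ≠ 0 := fun n => by
    have hodd : (2 * (n : ℝ) + 1) ≠ 0 := by
      have : (2 * (n : ℝ) + 1) = ((2 * n + 1 : ℤ) : ℝ) := by push_cast; ring
      rw [this]; exact_mod_cast (by omega : (2 * n + 1 : ℤ) ≠ 0)
    exact div_ne_zero (mul_ne_zero hodd Real.pi_ne_zero) hβ.ne'
  have hdiff : ∀ n : ℤ, ‖F n - A n‖ ≤ D₀ * cNR * (1 / (β * max |(2 * n + 1) * π / β| (Λ / 2) ^ 2)) := fun n => by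
    have h := norm_freqTerm_sub_kernelTerm_le (L := L) hβ Λ μ K (hω n) Δτ hN (hD _ (hω n)) z hR
    refine h.trans (le_of_eq ?_)
    rw [hcNR]
    push_cast
    field_simp
  obtain ⟨hs, hle⟩ := tsum_int_one_div_beta_mul_max_sq_le hβ (half_pos hΛ)
  have hgs : Summable (fun n : ℤ => D₀ * cNR * (1 / (β * max |(2 * n + 1) * π / β| (Λ / 2) ^ 2))) := hs.mul_left _
  have hdiffs : Summable (fun n : ℤ => F n - A n) := Summable.of_norm_bounded hgs hdiff
  have hAs : Summable A := by
    have h := hFs.sub hdiffs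
    simpa [hF, hA] using h
  refine ⟨hAs, ?_⟩
  rw [← Summable.tsum_sub hFs hAs]
  refine (norm_tsum_le_tsum_norm hdiffs.norm).trans ((hdiffs.norm.tsum_le_tsum hdiff hgs).trans ?_)
  rw [tsum_mul_left]
  calc D₀ * cNR * ∑' n : ℤ, 1 / (β * max |(2 * (n : ℝ) + 1) * π / β| (Λ / 2) ^ 2) ≤ D₀ * cNR * (1 / (Λ / 2)) :=
        mul_le_mul_of_nonneg_left (by exact_mod_cast hle) (by positivity)
    _ = D₀ * (2 / Λ) * cNR := by rw [one_div_div]; ring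

/-! ## §4 The bare frame `K = 0` with the proved cutoff table: explicit, hypothesis-free -/

/-- **Frequency-summable jet constant at the bare frame, `c = 1`, table-free**: for `N ≥ 1` and every `ω`,
`‖D^N g¹_ω(y)‖ ≤ (N!·klChi2CauchyTab N·(N+1)!·4·max(1, 4/Λ)^{N−1}·(8π)^N)/m(ω)²` (`…MomentumJets` §6 with `max(1,2/m) ≤ max(1,4/Λ)`, `m ≥ Λ/2`). -/
theorem norm_iteratedFDeriv_uvSpatialSymbol_one_bare_le_envSq {Λ : ℝ} (hΛ : 0 < Λ) (μ om : ℝ) {N : ℕ} (hN1 : 1 ≤ N) (y : Momentum) :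
    ‖iteratedFDeriv ℝ N (fun y : Momentum => uvSymbolFn 1 Λ (frameLevel μ 0 ((2 * π) • y)) om) y‖ ≤
      (N ! * klChi2CauchyTab N * (N + 1) ! * 4 * (max 1 (4 / Λ)) ^ (N - 1) * ((2 * π) * 4) ^ N) / max |om| (Λ / 2) ^ 2 := by
  have h := norm_iteratedFDeriv_uvSpatialSymbol_bare_le_of_one_le_tab zero_le_one hΛ μ om hN1 y
  refine h.trans ?_
  have hm : 0 < max |om| (Λ / 2) := lt_max_of_lt_right (by positivity)
  have hmΛ : Λ / 2 ≤ max |om| (Λ / 2) := le_max_right _ _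
  have hq : max 1 (2 / max |om| (Λ / 2)) ≤ max 1 (4 / Λ) := by
    refine max_le_max le_rfl ?_
    rw [div_le_div_iff₀ hm hΛ]
    nlinarith
  have htab : 0 ≤ klChi2CauchyTab N := zero_le_one.trans (one_le_klChi2CauchyTab N)
  calc (N ! : ℝ) * (1 * klChi2CauchyTab N * (N + 1) ! * (2 / max |om| (Λ / 2)) ^ 2 * (max 1 (2 / max |om| (Λ / 2))) ^ (N - 1)) * ((2 * π) * 4) ^ N
      ≤ (N ! : ℝ) * (1 * klChi2CauchyTab N * (N + 1) ! * (2 / max |om| (Λ / 2)) ^ 2 * (max 1 (4 / Λ)) ^ (N - 1)) * ((2 * π) * 4) ^ N := by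
        gcongr
    _ = (N ! * klChi2CauchyTab N * (N + 1) ! * 4 * (max 1 (4 / Λ)) ^ (N - 1) * ((2 * π) * 4) ^ N) / max |om| (Λ / 2) ^ 2 := by
        field_simp
        ring

/-- **(L) summed over all frequencies at the bare frame, table-free**: for `0 < β`, `0 < Λ`, `N ≥ 4`, every box radius `R`, every `L ≥ R + 1 + Σ_j|z_j|`,
every real `Δτ`, and a summable torus series:
`‖Σ'_n F_L(ω_n) − Σ'_n (1/β)e^{iω_nΔτ}a¹_{ω_n}(−z)‖ ≤ (N!·klChi2CauchyTab N·(N+1)!·4·max(1,4/Λ)^{N−1}·(8π)^N)·(2/Λ)·(2/(2R+2))^{N−4}·4C₂/(2π)^N`. -/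
theorem norm_tsum_freqTerm_sub_tsum_kernelTerm_le_bare {β : ℝ} (hβ : 0 < β) {Λ : ℝ} (hΛ : 0 < Λ) (μ : ℝ) (Δτ : ℝ) {N : ℕ} (hN : 2 * 2 ≤ N)
    {R : ℕ} (z : Site 2) (hR : (R : ℤ) + 1 + ∑ i, |z i| ≤ L)
    (hFs : Summable (fun n : ℤ => ((1 / (β * (L : ℝ) ^ 2) : ℝ) : ℂ) ^ 2 * cexp (I * (((2 * n + 1) * π / β * Δτ : ℝ) : ℂ)) *
        ∑ k, torusChar k (Torus.proj L z) * uvSymbolFn (β * (L : ℝ) ^ 2) Λ (nambuXiCT L μ 0 k) ((2 * n + 1) * π / β))) :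
    Summable (fun n : ℤ => ((1 / β : ℝ) : ℂ) * cexp (I * (((2 * n + 1) * π / β * Δτ : ℝ) : ℂ)) * mFourierCoeff (Torus.descend
        (fun y : Momentum => uvSymbolFn 1 Λ (frameLevel μ 0 ((2 * π) • y)) ((2 * n + 1) * π / β))
        (uvSpatialSymbol_isLatticePeriodic 1 Λ μ 0 ((2 * n + 1) * π / β))) (-z)) ∧
    ‖∑' n : ℤ, ((1 / (β * (L : ℝ) ^ 2) : ℝ) : ℂ) ^ 2 * cexp (I * (((2 * n + 1) * π / β * Δτ : ℝ) : ℂ)) *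
          ∑ k, torusChar k (Torus.proj L z) * uvSymbolFn (β * (L : ℝ) ^ 2) Λ (nambuXiCT L μ 0 k) ((2 * n + 1) * π / β) -
        ∑' n : ℤ, ((1 / β : ℝ) : ℂ) * cexp (I * (((2 * n + 1) * π / β * Δτ : ℝ) : ℂ)) * mFourierCoeff (Torus.descend
          (fun y : Momentum => uvSymbolFn 1 Λ (frameLevel μ 0 ((2 * π) • y)) ((2 * n + 1) * π / β))
          (uvSpatialSymbol_isLatticePeriodic 1 Λ μ 0 ((2 * n + 1) * π / β))) (-z)‖ ≤
      (N ! * klChi2CauchyTab N * (N + 1) ! * 4 * (max 1 (4 / Λ)) ^ (N - 1) * ((2 * π) * 4) ^ N) * (2 / Λ) *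
        (1 / (2 * Real.pi) ^ N * (2 / ((2 * R + 2 : ℕ) : ℝ)) ^ (N - 2 * 2) * (2 ^ 2 * ∑' k : Site 2, ∏ j, (1 + (k j : ℝ) ^ 2)⁻¹)) := by
  have htab : 0 ≤ klChi2CauchyTab N := zero_le_one.trans (one_le_klChi2CauchyTab N)
  exact norm_tsum_freqTerm_sub_tsum_kernelTerm_le hβ hΛ μ 0 Δτ hN (by positivity)
    (fun om _ y => norm_iteratedFDeriv_uvSpatialSymbol_one_bare_le_envSq hΛ μ om (by omega) y) z hR hFs

/-- **The off-site scale-`0` entry IS the infinite-lattice frequency series, up to two explicit tails** (bare frame, table-free): for `z̄ ≠ 0`, `0 < β`,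
`0 < Λ`, `1 ≤ M`, `N ≥ 4`, every box radius `R`, every `L ≥ R + 1 + Σ_j|z_j|`, every real `Δτ`:
`‖Σ_{i∈MatsubaraIdx M} F_L(ω_i) − Σ'_n (1/β)e^{iω_nΔτ}a¹_{ω_n}(−z)‖ ≤ (19/3)(4+|μ|)·β/(2π²M) + D₀(N,Λ)·(2/Λ)·(2/(2R+2))^{N−4}·4C₂/(2π)^N`
((M) `…OffSiteExplicit` + §4). -/
theorem norm_sum_freqTerm_sub_tsum_kernelTerm_le_bare {β : ℝ} (hβ : 0 < β) {Λ : ℝ} (hΛ : 0 < Λ) {M : ℕ} (hM : 0 < M) (μ : ℝ) (Δτ : ℝ)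
    {N : ℕ} (hN : 2 * 2 ≤ N) {R : ℕ} {z : Site 2} (hz : Torus.proj L z ≠ 0) (hR : (R : ℤ) + 1 + ∑ i, |z i| ≤ L) :
    ‖∑ i : MatsubaraIdx M, ((1 / (β * (L : ℝ) ^ 2) : ℝ) : ℂ) ^ 2 * cexp (I * ((matsubaraFreq β M i * Δτ : ℝ) : ℂ)) *
          ∑ k, torusChar k (Torus.proj L z) * uvSymbolFn (β * (L : ℝ) ^ 2) Λ (nambuXiCT L μ 0 k) (matsubaraFreq β M i) -
        ∑' n : ℤ, ((1 / β : ℝ) : ℂ) * cexp (I * (((2 * n + 1) * π / β * Δτ : ℝ) : ℂ)) * mFourierCoeff (Torus.descend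
          (fun y : Momentum => uvSymbolFn 1 Λ (frameLevel μ 0 ((2 * π) • y)) ((2 * n + 1) * π / β))
          (uvSpatialSymbol_isLatticePeriodic 1 Λ μ 0 ((2 * n + 1) * π / β))) (-z)‖ ≤
      (19 / 3) * (4 + |μ| + (0 : TrigPolyC4v).coeffNorm 0) * β / (2 * π ^ 2 * M) +
        (N ! * klChi2CauchyTab N * (N + 1) ! * 4 * (max 1 (4 / Λ)) ^ (N - 1) * ((2 * π) * 4) ^ N) * (2 / Λ) *
          (1 / (2 * Real.pi) ^ N * (2 / ((2 * R + 2 : ℕ) : ℝ)) ^ (N - 2 * 2) * (2 ^ 2 * ∑' k : Site 2, ∏ j, (1 + (k j : ℝ) ^ 2)⁻¹)) := by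
  obtain ⟨hFs, hM'⟩ := norm_sum_freqTerm_nambuXiCT_sub_tsum_le_of_ne_zero hΛ hβ hM μ 0 Δτ hz
  obtain ⟨_, hL'⟩ := norm_tsum_freqTerm_sub_tsum_kernelTerm_le_bare hβ hΛ μ Δτ hN z hR hFs
  exact (norm_sub_le_norm_sub_add_norm_sub _ _ _).trans (add_le_add hM' hL')

end Summit.HubbardSuperconductivity.HubbardSuperconductivity.Theorems.KLRegimeSplit

end
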